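import Mathlib
import Summits.NavierStokesRegularity.NavierStokesRegularity.Theorems.EulerZoomLiouvillePowerGaugeEulerLiouvilleDriftClockInvariant
import Summits.NavierStokesRegularity.NavierStokesRegularity.Theorems.EulerZoomLiouvillePowerGaugeEulerLiouvilleNeedleClockLocal
import Summits.NavierStokesRegularity.NavierStokesRegularity.Theorems.EulerZoomLiouvillePowerGaugeEulerLiouvilleCondenserMinimalType
import Summits.NavierStokesRegularity.NavierStokesRegularity.Theorems.EulerZoomLiouvillePowerGaugeEulerLiouvilleSelfSimilarPastStrata
import HarnessLib

/-!
# «ANY INWARD DRIFT KILLS», IX (T-H′ members): a POWER-LAW band deficit carried by a backward-invariant open vortical region kills — centred and past-exact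
# (crux `EulerZoomLiouville.PowerGaugeEulerLiouville` = stmt-NavierStokesRegularity-19832, THE ONE STATEMENT `stub_selfSimilarC2Needle`; via `HasResidenceClock` alt 6 «one clocked ball»)

Route `EulerZoomLiouville` (NavierStokesRegularity), crux E; width seat ns-ezl-w1 g6.  By-name assembly of the LEVEL-FREE engine
`DriftClock.powerClockAt_of_invariantBandDeficit` (`…DriftClockInvariant`) with the LEAD's local thresholds
`NeedleRace.selfSimilar_ae_eq_zero_of_localPowerClockC2` / `…_past` (`…NeedleClockLocal`, v88) over a classical pressure of the profile.
With `W y = γy + V y`, `γ = 1/(2+ρ)`, `ℛ(y) = ⟪y, W y⟫`, `a(y) = ‖W y‖² + γℛ(y) + ⟪y, DV(y)(W y)⟫`: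

* `DriftClock.scaleBand_of_rpowBand`, `DriftClock.rpowBudget` — bookkeeping: a pointwise power-law band/floor (`κb‖y‖^{−p}`, `a₀‖y‖^{−q}`, `0 ≤ p`,
  `0 ≤ q`) on a set is the scale-indexed one with `κ(R) = κb(2R)^{−p}`, `a(R) = a₀(2R)^{−q}` on `‖y‖ ≤ 2R`; its budget is `o(R^{2+ρ})` iff `p < ρ`, `q < 2+ρ+p`.
* **`Loc.selfSimilar_ae_eq_zero_of_invariantBandDeficitC2_profile`** — crux hypotheses (`0 < ρ ≤ ½`), exact self-similarity about the origin, `V ∈ C²`, and,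
  for every classical pressure `P′`: an OPEN set `O`, BACKWARD-INVARIANT for the similarity flow (`Z′ = −W(Z)` on `[0,t]`, `Z 0 ∈ O ⇒ Z t ∈ O`), containing a
  VORTICAL point, and constants `κb, a₀ > 0`, `0 ≤ e₁ < ρ`, `0 ≤ e₂ < 2+ρ+e₁`, `Rf` with: every vortical `y ∈ O`, `‖y‖ ≥ Rf`, in the band
  `−κb‖y‖^{−e₁} ≤ ℛ(y) ≤ 0` has `a(y) ≥ a₀‖y‖^{−e₂}` ⇒ `u = 0` a.e. on the slab.  ⊇ alternative 8 (`O = {ℋ_{P′} > h}` for every `h`,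
  `DriftClock.backwardInvariant_bernoulliSuperlevel`); admits regions that are not Bernoulli super-level sets (invariant far inflow cones, sectors, tubes).
* **`Past.selfSimilar_ae_eq_zero_of_invariantBandDeficitC2_profile_past`** — the same for members exactly self-similar about `(T, x₀)` for `τ < T₁` only.

WHAT THIS IS NOT: not NS, not E — strata on the model lattice; DENT 0 on the registered stubs; 19832 OPEN; NS regularity is NOT proved; no summit statement is
proved by this seat. [folklore; ConstantinIgnatovaVicol2026Putative §3.4–§3.5]
-/
noncomputable section

-- flat `Theorems/<Route><Decl>…` files of one crux share the namespace of the crux (tree convention: `Summit.<S>.<S>.…`)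
set_option linter.dupNamespace false

open Set Filter Topology Metric Function MeasureTheory
open scoped RealInnerProductSpace NNReal ENNReal

namespace Summit.NavierStokesRegularity.NavierStokesRegularity.Theorems.PowerGaugeEulerLiouville

open Literature.Analysis Literature.Analysis.FluidPDE

namespace DriftClock

/-- **Pointwise power-law band ⇒ scale-indexed band** (`0 ≤ p`, `0 ≤ q`, `κb, a₀ ≥ 0`): on `1 ≤ ‖y‖ ≤ 2R` the band `−κb(2R)^{−p} ≤ ℛ ≤ 0` lies inside
`−κb‖y‖^{−p} ≤ ℛ ≤ 0`, and the floor `a₀‖y‖^{−q}` is at least `a₀(2R)^{−q}`. [folklore] -/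
theorem scaleBand_of_rpowBand {γ κb a₀ p q Rf : ℝ} {V : EuclideanSpace ℝ (Fin 3) → EuclideanSpace ℝ (Fin 3)}
    {S : Set (EuclideanSpace ℝ (Fin 3))} (hκb : 0 ≤ κb) (ha₀ : 0 ≤ a₀) (hp0 : 0 ≤ p) (hq0 : 0 ≤ q)
    (hdef : ∀ y ∈ S, Rf ≤ ‖y‖ → curl V y ≠ 0 →
      -(κb * ‖y‖ ^ (-p)) ≤ ⟪y, selfSimilarTransport γ 0 V y⟫ → ⟪y, selfSimilarTransport γ 0 V y⟫ ≤ 0 →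
        a₀ * ‖y‖ ^ (-q) ≤ ‖selfSimilarTransport γ 0 V y‖ ^ 2 + γ * ⟪y, selfSimilarTransport γ 0 V y⟫ +
          ⟪y, fderiv ℝ V y (selfSimilarTransport γ 0 V y)⟫) :
    ∀ (R : ℝ) (y : EuclideanSpace ℝ (Fin 3)), y ∈ S → max Rf 1 ≤ ‖y‖ → ‖y‖ ≤ 2 * R → curl V y ≠ 0 →
      -(κb * (2 * R) ^ (-p)) ≤ ⟪y, selfSimilarTransport γ 0 V y⟫ → ⟪y, selfSimilarTransport γ 0 V y⟫ ≤ 0 →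
        a₀ * (2 * R) ^ (-q) ≤ ‖selfSimilarTransport γ 0 V y‖ ^ 2 + γ * ⟪y, selfSimilarTransport γ 0 V y⟫ +
          ⟪y, fderiv ℝ V y (selfSimilarTransport γ 0 V y)⟫ := by
  intro R y hyS hy1 hy2 hc hlo hhi
  have hypos : 0 < ‖y‖ := lt_of_lt_of_le one_pos ((le_max_right _ _).trans hy1)
  have h2R : 0 < 2 * R := lt_of_lt_of_le hypos hy2
  have hband : -(κb * ‖y‖ ^ (-p)) ≤ ⟪y, selfSimilarTransport γ 0 V y⟫ := by
    have hmono : (2 * R) ^ (-p) ≤ ‖y‖ ^ (-p) := by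
      rw [Real.rpow_neg h2R.le, Real.rpow_neg hypos.le]
      exact inv_anti₀ (Real.rpow_pos_of_pos hypos _) (Real.rpow_le_rpow hypos.le hy2 hp0)
    have : κb * (2 * R) ^ (-p) ≤ κb * ‖y‖ ^ (-p) := mul_le_mul_of_nonneg_left hmono hκb
    linarith only [this, hlo]
  have hdy := hdef y hyS ((le_max_left _ _).trans hy1) hc hband hhi
  have hle : a₀ * (2 * R) ^ (-q) ≤ a₀ * ‖y‖ ^ (-q) := by
    have hmono : (2 * R) ^ (-q) ≤ ‖y‖ ^ (-q) := by
      rw [Real.rpow_neg h2R.le, Real.rpow_neg hypos.le]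
      exact inv_anti₀ (Real.rpow_pos_of_pos hypos _) (Real.rpow_le_rpow hypos.le hy2 hq0)
    exact mul_le_mul_of_nonneg_left hmono ha₀
  exact hle.trans hdy

/-- **The power-law budget is `o(R^{2+ρ})`** (`κb, a₀ > 0`, `p < ρ`, `q < 2+ρ+p` — so `ρ > 0` is implicit —, every `c′ > 0`): eventually
`2κb(2R)^{−p}/(a₀(2R)^{−q}) + 3R²/(κb(2R)^{−p}) ≤ c′R^{2+ρ}` (transit `≍ R^{q−p}`, escape `≍ R^{2+p}`). [folklore] -/
theorem rpowBudget {ρ κb a₀ p q : ℝ} (hκb : 0 < κb) (ha₀ : 0 < a₀) (hpρ : p < ρ) (hqρ : q < 2 + ρ + p) :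
    ∀ c' : ℝ, 0 < c' → ∀ᶠ R : ℝ in atTop,
      2 * (κb * (2 * R) ^ (-p)) / (a₀ * (2 * R) ^ (-q)) + 3 * R ^ 2 / (κb * (2 * R) ^ (-p)) ≤ c' * R ^ (2 + ρ) := by
  intro c' hc'
  have hgen : ∀ A e : ℝ, e < 2 + ρ → ∀ᶠ R : ℝ in atTop, A * R ^ e ≤ c' * R ^ (2 + ρ) / 2 := by
    intro A e he
    have hlim : Tendsto (fun R : ℝ => A * R ^ (e - (2 + ρ))) atTop (𝓝 0) := by
      have h := tendsto_rpow_neg_atTop (show 0 < (2 + ρ) - e by linarith)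
      have h' : Tendsto (fun R : ℝ => A * R ^ (-((2 + ρ) - e))) atTop (𝓝 (A * 0)) := h.const_mul A
      rw [mul_zero] at h'
      refine h'.congr' (Eventually.of_forall fun R => ?_)
      simp only [neg_sub]
    have hsmall : ∀ᶠ R : ℝ in atTop, A * R ^ (e - (2 + ρ)) < c' / 2 := (tendsto_order.1 hlim).2 _ (by positivity)
    filter_upwards [hsmall, eventually_gt_atTop (0 : ℝ)] with R hR hR0
    have hsplit : A * R ^ e = A * R ^ (e - (2 + ρ)) * R ^ (2 + ρ) := by
      rw [mul_assoc, ← Real.rpow_add hR0]; ring_nf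
    rw [hsplit]
    have hRpow : 0 < R ^ (2 + ρ) := Real.rpow_pos_of_pos hR0 _
    have := mul_le_mul_of_nonneg_right hR.le hRpow.le
    linarith only [this]
  have h2 : ∀ᶠ R : ℝ in atTop, 2 * (κb * (2 * R) ^ (-p)) / (a₀ * (2 * R) ^ (-q)) ≤ c' * R ^ (2 + ρ) / 2 := by
    filter_upwards [hgen (2 * κb / a₀ * (2 : ℝ) ^ (q - p)) (q - p) (by linarith), eventually_gt_atTop (0 : ℝ)] with R hR hR0
    have e : 2 * (κb * (2 * R) ^ (-p)) / (a₀ * (2 * R) ^ (-q)) = 2 * κb / a₀ * (2 : ℝ) ^ (q - p) * R ^ (q - p) := by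
      rw [Real.mul_rpow (by norm_num) hR0.le, Real.mul_rpow (by norm_num) hR0.le]
      have hq' : (2 : ℝ) ^ (-q) * R ^ (-q) ≠ 0 := by positivity
      have ha' : a₀ ≠ 0 := ha₀.ne'
      rw [div_eq_iff (mul_ne_zero ha' hq')]
      rw [show 2 * κb / a₀ * (2 : ℝ) ^ (q - p) * R ^ (q - p) * (a₀ * ((2 : ℝ) ^ (-q) * R ^ (-q))) =
        2 * κb * (a₀ / a₀) * ((2 : ℝ) ^ (q - p) * (2 : ℝ) ^ (-q)) * (R ^ (q - p) * R ^ (-q)) by ring,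
        div_self ha', ← Real.rpow_add two_pos, ← Real.rpow_add hR0]
      ring_nf
    rwa [e]
  have h3 : ∀ᶠ R : ℝ in atTop, 3 * R ^ 2 / (κb * (2 * R) ^ (-p)) ≤ c' * R ^ (2 + ρ) / 2 := by
    filter_upwards [hgen (3 * (2 : ℝ) ^ p / κb) (2 + p) (by linarith), eventually_gt_atTop (0 : ℝ)] with R hRA hR0
    have e : 3 * R ^ 2 / (κb * (2 * R) ^ (-p)) = 3 * (2 : ℝ) ^ p / κb * R ^ (2 + p) := by
      rw [Real.mul_rpow (by norm_num) hR0.le, Real.rpow_neg (by norm_num : (0:ℝ) ≤ 2), Real.rpow_neg hR0.le,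
        Real.rpow_add hR0, Real.rpow_two]
      have h2p : (2 : ℝ) ^ p ≠ 0 := by positivity
      have hRp : R ^ p ≠ 0 := by positivity
      field_simp
    rwa [e]
  filter_upwards [h2, h3] with R h2 h3
  linarith only [h2, h3]

/-- **LEVEL-FREE POWER-LAW CLOCK AT A BALL**: an open backward-invariant region `O` carrying the pointwise power-law band deficit (`κb‖y‖^{−p}`, `a₀‖y‖^{−q}`,
`0 ≤ p < ρ`, `0 ≤ q < 2+ρ+p`) beyond radius `Rf` clocks every vortical `x₀ ∈ O` — `DriftClock.powerClockAt_of_invariantBandDeficit` ∘ the two bookkeeping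
lemmas above. [folklore; cf. ConstantinIgnatovaVicol2026Putative §3.4–§3.5] -/
theorem powerClockAt_of_invariantPowerBandDeficit {ρ : ℝ} (hρ : 0 < ρ) (hρh : ρ ≤ 1 / 2)
    {V : EuclideanSpace ℝ (Fin 3) → EuclideanSpace ℝ (Fin 3)} {P' : EuclideanSpace ℝ (Fin 3) → ℝ}
    (hprof : IsSelfSimilarEulerProfile (1 / (2 + ρ)) 0 V P') {O : Set (EuclideanSpace ℝ (Fin 3))} (hO : IsOpen O)
    (hinv : ∀ (Z : ℝ → EuclideanSpace ℝ (Fin 3)) (t : ℝ), 0 ≤ t →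
      (∀ s ∈ Icc 0 t, HasDerivAt Z (-(selfSimilarTransport (1 / (2 + ρ)) 0 V (Z s))) s) → Z 0 ∈ O → Z t ∈ O)
    {κb a₀ p q Rf : ℝ} (hκb : 0 < κb) (ha₀ : 0 < a₀) (hp0 : 0 ≤ p) (hpρ : p < ρ) (hq0 : 0 ≤ q) (hqρ : q < 2 + ρ + p)
    (hdef : ∀ y ∈ O, Rf ≤ ‖y‖ → curl V y ≠ 0 →
      -(κb * ‖y‖ ^ (-p)) ≤ ⟪y, selfSimilarTransport (1 / (2 + ρ)) 0 V y⟫ → ⟪y, selfSimilarTransport (1 / (2 + ρ)) 0 V y⟫ ≤ 0 →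
        a₀ * ‖y‖ ^ (-q) ≤ ‖selfSimilarTransport (1 / (2 + ρ)) 0 V y‖ ^ 2 +
          (1 / (2 + ρ)) * ⟪y, selfSimilarTransport (1 / (2 + ρ)) 0 V y⟫ +
          ⟪y, fderiv ℝ V y (selfSimilarTransport (1 / (2 + ρ)) 0 V y)⟫)
    {x₀ : EuclideanSpace ℝ (Fin 3)} (hx₀O : x₀ ∈ O) (hx₀ : curl V x₀ ≠ 0) :
    ∀ c' : ℝ, 0 < c' → ∃ r : ℝ, 0 < r ∧ ∃ R₀ : ℝ,
      ∀ R : ℝ, R₀ ≤ R → ∀ (V' : EuclideanSpace ℝ (Fin 3) → EuclideanSpace ℝ (Fin 3)) (K Rbig : ℝ), ContDiff ℝ 2 V' →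
        (∀ y, ‖fderiv ℝ V' y‖ ≤ K) → 2 * R < Rbig →
        (∀ w ∈ ball (0 : EuclideanSpace ℝ (Fin 3)) Rbig, V' w = V w) →
        (volume (ball x₀ r ∩ {y | ∀ σ ∈ Icc 0 (c' * R ^ (2 + ρ)),
          ‖ODE.evolutionMap (fun _ : ℝ => selfSimilarTransport (1 / (2 + ρ)) 0 V') 0 (-σ) y‖ ≤ 2 * R})).toReal ≤
          (volume (ball x₀ r)).toReal / 2 :=
  powerClockAt_of_invariantBandDeficit hρ hρh hprof hO hinv (κ := fun R => κb * (2 * R) ^ (-p))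
    (a := fun R => a₀ * (2 * R) ^ (-q)) (fun R _ => by positivity) (fun R _ => by positivity)
    (scaleBand_of_rpowBand hκb.le ha₀.le hp0 hq0 hdef) (rpowBudget hκb ha₀ hpρ hqρ) hx₀O hx₀

end DriftClock

/-- **EXACTLY SELF-SIMILAR MEMBERS WITH A BACKWARD-INVARIANT VORTICAL REGION CARRYING A POWER-LAW BAND DEFICIT ARE TRIVIAL** (see the module docstring; crux
hypotheses verbatim, `0 < ρ ≤ ½`, exact self-similarity about the origin, `V ∈ C²`).  Proof = classical pressure ⇒ `DriftClock.powerClockAt_of_invariantPowerBandDeficit`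
⇒ `NeedleRace.selfSimilar_ae_eq_zero_of_localPowerClockC2` («one clocked ball kills»). [folklore; ConstantinIgnatovaVicol2026Putative §3.4–§3.5] -/
theorem Loc.selfSimilar_ae_eq_zero_of_invariantBandDeficitC2_profile {ρ : ℝ} (hρ : 0 < ρ) (hρ1 : ρ ≤ 1 / 2)
    {u : ℝ → EuclideanSpace ℝ (Fin 3) → EuclideanSpace ℝ (Fin 3)} {p : ℝ → EuclideanSpace ℝ (Fin 3) → ℝ}
    {H : ℝ → EuclideanSpace ℝ (Fin 3) → EuclideanSpace ℝ (Fin 3) →L[ℝ] EuclideanSpace ℝ (Fin 3)} {c : ℝ≥0}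
    (hsw : IsSuitableWeakSolutionOn (slab (EuclideanSpace ℝ (Fin 3)) (Iio 0) isOpen_Iio) 0 0 u p)
    (hH : HasWeakSpatialGradientOn (slab (EuclideanSpace ℝ (Fin 3)) (Iio 0) isOpen_Iio) u H)
    (hgauge : ∀ a : ℝ, 0 < a →
      ENNReal.ofReal (a ^ (2 * ρ)) * cknA a (0 : ℝ × EuclideanSpace ℝ (Fin 3)) u +
          ENNReal.ofReal (a ^ ρ) * cknE a (0 : ℝ × EuclideanSpace ℝ (Fin 3)) H +
        ENNReal.ofReal (a ^ (2 * ρ)) * cknD a (0 : ℝ × EuclideanSpace ℝ (Fin 3)) p ≤ (c : ℝ≥0∞))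
    {V : EuclideanSpace ℝ (Fin 3) → EuclideanSpace ℝ (Fin 3)} {P : EuclideanSpace ℝ (Fin 3) → ℝ}
    (hu : ∀ τ : ℝ, τ < 0 → u τ = selfSimilarCollapse (1 / (2 + ρ)) 0 V τ)
    (hp : ∀ τ : ℝ, τ < 0 → p τ = selfSimilarCollapsePressure (1 / (2 + ρ)) 0 P τ)
    (hV : ContDiff ℝ 2 V)
    (hB : ∀ P' : EuclideanSpace ℝ (Fin 3) → ℝ, IsSelfSimilarEulerProfile (1 / (2 + ρ)) 0 V P' →
      ∃ O : Set (EuclideanSpace ℝ (Fin 3)), IsOpen O ∧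
        (∀ (Z : ℝ → EuclideanSpace ℝ (Fin 3)) (t : ℝ), 0 ≤ t →
          (∀ s ∈ Icc 0 t, HasDerivAt Z (-(selfSimilarTransport (1 / (2 + ρ)) 0 V (Z s))) s) → Z 0 ∈ O → Z t ∈ O) ∧
        (∃ x₀ ∈ O, curl V x₀ ≠ 0) ∧
        ∃ κb a₀ e₁ e₂ Rf : ℝ, 0 < κb ∧ 0 < a₀ ∧ 0 ≤ e₁ ∧ e₁ < ρ ∧ 0 ≤ e₂ ∧ e₂ < 2 + ρ + e₁ ∧
          ∀ y ∈ O, Rf ≤ ‖y‖ → curl V y ≠ 0 →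
            -(κb * ‖y‖ ^ (-e₁)) ≤ ⟪y, selfSimilarTransport (1 / (2 + ρ)) 0 V y⟫ →
            ⟪y, selfSimilarTransport (1 / (2 + ρ)) 0 V y⟫ ≤ 0 →
            a₀ * ‖y‖ ^ (-e₂) ≤ ‖selfSimilarTransport (1 / (2 + ρ)) 0 V y‖ ^ 2 +
              (1 / (2 + ρ)) * ⟪y, selfSimilarTransport (1 / (2 + ρ)) 0 V y⟫ +
              ⟪y, fderiv ℝ V y (selfSimilarTransport (1 / (2 + ρ)) 0 V y)⟫) :
    uncurry u =ᵐ[volume.restrict (Iio (0 : ℝ) ×ˢ (univ : Set (EuclideanSpace ℝ (Fin 3))))] 0 := by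
  have hρ1' : ρ < 1 := by linarith
  -- ### a classical pressure for the profile
  have hD : ∀ a : ℝ, 0 < a → ENNReal.ofReal (a ^ (2 * ρ)) *
      cknD a (0 : ℝ × EuclideanSpace ℝ (Fin 3)) p ≤ (c : ℝ≥0∞) :=
    fun a ha => le_trans le_add_self (hgauge a ha)
  have hpm : AEStronglyMeasurable (uncurry p)
      (volume.restrict (Iio (0 : ℝ) ×ˢ (univ : Set (EuclideanSpace ℝ (Fin 3))))) := by
    have := hsw.distributional.2.2.1.aestronglyMeasurable
    simpa [slab] using this
  have hPm := aestronglyMeasurable_pressureProfile hpm hp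
  have hDprof := profile_pressure_weight_of_gaugeD hρ hρ1' hpm hp hD
  have hP1 : LocallyIntegrable P volume :=
    EnergySaturation.locallyIntegrable_pressure_of_weight hρ1' hPm
      (ENNReal.mul_ne_top ENNReal.ofReal_ne_top ENNReal.coe_ne_top) hDprof
  obtain ⟨P', hprof⟩ :=
    WeakToClassical.exists_isSelfSimilarEulerProfile_of_contDiff hsw.distributional hu hp hV hP1
  -- ### the region, its vortical point, and the clock at that point
  obtain ⟨O, hO, hinv, ⟨x₀, hx₀O, hx₀⟩, κb, a₀, e₁, e₂, Rf, hκb, ha₀, he₁, he₁ρ, he₂, he₂ρ, hdef⟩ := hB P' hprof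
  have hclock := DriftClock.powerClockAt_of_invariantPowerBandDeficit hρ hρ1 hprof hO hinv hκb ha₀ he₁ he₁ρ he₂ he₂ρ hdef hx₀O hx₀
  -- ### «one clocked ball kills»
  exact NeedleRace.selfSimilar_ae_eq_zero_of_localPowerClockC2 hρ hρ1 hsw hH hgauge hu hp hV
    (fun c' hc' => ⟨x₀, hclock c' hc'⟩)

namespace Past

variable {ρ T T₁ : ℝ}
  {u : ℝ → EuclideanSpace ℝ (Fin 3) → EuclideanSpace ℝ (Fin 3)} {p : ℝ → EuclideanSpace ℝ (Fin 3) → ℝ}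
  {H : ℝ → EuclideanSpace ℝ (Fin 3) → EuclideanSpace ℝ (Fin 3) →L[ℝ] EuclideanSpace ℝ (Fin 3)} {c : ℝ≥0}
  {V : EuclideanSpace ℝ (Fin 3) → EuclideanSpace ℝ (Fin 3)} {P : EuclideanSpace ℝ (Fin 3) → ℝ}

/-- **PAST-EXACT MEMBER WITH A BACKWARD-INVARIANT VORTICAL REGION CARRYING A POWER-LAW BAND DEFICIT IS TRIVIAL** (crux hypotheses verbatim, `0 < ρ ≤ ½`;
exact self-similarity about `(T, x₀)` for `τ < T₁`, `T₁ ≤ 0`, `T₁ ≤ T`; `V ∈ C²`).  Proof = `Past.exists_isSelfSimilarEulerProfile` ⇒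
`DriftClock.powerClockAt_of_invariantPowerBandDeficit` ⇒ `NeedleRace.selfSimilar_ae_eq_zero_of_localPowerClockC2_past`. [folklore; ConstantinIgnatovaVicol2026Putative §3.4–§3.5] -/
theorem selfSimilar_ae_eq_zero_of_invariantBandDeficitC2_profile_past (hρ : 0 < ρ) (hρh : ρ ≤ 1 / 2) (hT₁ : T₁ ≤ 0)
    (hTT₁ : T₁ ≤ T) (x₀ : EuclideanSpace ℝ (Fin 3))
    (hsw : IsSuitableWeakSolutionOn (slab (EuclideanSpace ℝ (Fin 3)) (Iio 0) isOpen_Iio) 0 0 u p)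
    (hH : HasWeakSpatialGradientOn (slab (EuclideanSpace ℝ (Fin 3)) (Iio 0) isOpen_Iio) u H)
    (hgauge : ∀ a : ℝ, 0 < a →
      ENNReal.ofReal (a ^ (2 * ρ)) * cknA a (0 : ℝ × EuclideanSpace ℝ (Fin 3)) u +
          ENNReal.ofReal (a ^ ρ) * cknE a (0 : ℝ × EuclideanSpace ℝ (Fin 3)) H +
        ENNReal.ofReal (a ^ (2 * ρ)) * cknD a (0 : ℝ × EuclideanSpace ℝ (Fin 3)) p ≤ (c : ℝ≥0∞))
    (hu : ∀ τ : ℝ, τ < T₁ → u τ = fun x => selfSimilarCollapse (1 / (2 + ρ)) T V τ (x - x₀))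
    (hp : ∀ τ : ℝ, τ < T₁ → p τ = fun x => selfSimilarCollapsePressure (1 / (2 + ρ)) T P τ (x - x₀))
    (hV : ContDiff ℝ 2 V)
    (hB : ∀ P' : EuclideanSpace ℝ (Fin 3) → ℝ, IsSelfSimilarEulerProfile (1 / (2 + ρ)) 0 V P' →
      ∃ O : Set (EuclideanSpace ℝ (Fin 3)), IsOpen O ∧
        (∀ (Z : ℝ → EuclideanSpace ℝ (Fin 3)) (t : ℝ), 0 ≤ t →
          (∀ s ∈ Icc 0 t, HasDerivAt Z (-(selfSimilarTransport (1 / (2 + ρ)) 0 V (Z s))) s) → Z 0 ∈ O → Z t ∈ O) ∧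
        (∃ x₁ ∈ O, curl V x₁ ≠ 0) ∧
        ∃ κb a₀ e₁ e₂ Rf : ℝ, 0 < κb ∧ 0 < a₀ ∧ 0 ≤ e₁ ∧ e₁ < ρ ∧ 0 ≤ e₂ ∧ e₂ < 2 + ρ + e₁ ∧
          ∀ y ∈ O, Rf ≤ ‖y‖ → curl V y ≠ 0 →
            -(κb * ‖y‖ ^ (-e₁)) ≤ ⟪y, selfSimilarTransport (1 / (2 + ρ)) 0 V y⟫ →
            ⟪y, selfSimilarTransport (1 / (2 + ρ)) 0 V y⟫ ≤ 0 →
            a₀ * ‖y‖ ^ (-e₂) ≤ ‖selfSimilarTransport (1 / (2 + ρ)) 0 V y‖ ^ 2 +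
              (1 / (2 + ρ)) * ⟪y, selfSimilarTransport (1 / (2 + ρ)) 0 V y⟫ +
              ⟪y, fderiv ℝ V y (selfSimilarTransport (1 / (2 + ρ)) 0 V y)⟫) :
    uncurry u =ᵐ[volume.restrict (Iio (0 : ℝ) ×ˢ (univ : Set (EuclideanSpace ℝ (Fin 3))))] 0 := by
  -- ### a classical pressure for the profile (far-past extension)
  obtain ⟨P', hprof⟩ := exists_isSelfSimilarEulerProfile hρ hT₁ hTT₁ hsw.distributional hu hp hV
  -- ### the region, its vortical point, and the clock at that point
  obtain ⟨O, hO, hinv, ⟨x₁, hx₁O, hx₁⟩, κb, a₀, e₁, e₂, Rf, hκb, ha₀, he₁, he₁ρ, he₂, he₂ρ, hdef⟩ := hB P' hprof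
  have hclock := DriftClock.powerClockAt_of_invariantPowerBandDeficit hρ hρh hprof hO hinv hκb ha₀ he₁ he₁ρ he₂ he₂ρ hdef hx₁O hx₁
  -- ### «one clocked ball kills» (past twin)
  exact NeedleRace.selfSimilar_ae_eq_zero_of_localPowerClockC2_past hρ hρh hT₁ hTT₁ x₀ hsw hH hgauge hu hp hV
    (fun c' hc' => ⟨x₁, hclock c' hc'⟩)

end Past

end Summit.NavierStokesRegularity.NavierStokesRegularity.Theorems.PowerGaugeEulerLiouville

end
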